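import Literature.AlgebraicGeometry.Motives.CartierDivisorCurveDegree
import HarnessLib

/-!
# An effective Cartier divisor on an integral proper curve has at most `deg D` zeros

Topic `AlgebraicGeometry/Motives`; namespace `Literature.AlgebraicGeometry.Motives.CartierDivisor`.  THEOREMS ONLY
(no definition, no named fact, no instance, no `sorry`).  Generic companion of ★ `Motives/CartierDivisorCurveDegree`
(`CartierDivisor.degree C D = Σ_x ord_x(D)·[κ(x):K]`, `IsEffective.degree_pos`): the positivity statement there
(«an effective divisor with a genuine zero has positive degree») upgraded to the COUNT of zeros.  Cell `hodgecm-mathlib`,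
count-neutral PROOF-lane capital for F-DAG leaf F-9 (9a) (the integral-component step of the inequality
`#(γ ∩ H) ≤ (γ · H)` in [MumfordFogartyKirwan1994, Ch. 7 §3, proof of Prop. 7.7]); nothing here is about HC.

* `IsEffective.sum_residueDegree_le_degree` — for an EFFECTIVE Cartier divisor `D` on an integral proper curve `C / K`
  (`height ⊤ = 1`) and a finite set `S` of closed points NOT avoided by `D` (zeros of `D`),
  `Σ_{x ∈ S} [κ(x) : K] ≤ deg D`;
* `avoids_top`, `height_eq_zero_of_not_avoids` — every divisor avoids the generic point; on a curve its zeros∕poles are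
  closed points;
* `IsEffective.finite_setOf_not_avoids`, **`IsEffective.ncard_setOf_not_avoids_le_degree`**, `IsEffective.card_le_degree`
  — the zeros of `D` are finitely many, at most `deg D` of them (each zero contributes `ord_x(D)·[κ(x):K] ≥ 1`,
  ★ `IsEffective.ordAt_pos`, ★ `residueDegree_toSpecOver_ne_zero`);
* `Avoids.pullbackAvoiding_of_apply`, `IsEffective.avoids_pullbackAvoiding_iff` — `Supp (φ^* H) = φ⁻¹ (Supp H)` for an
  effective `H` avoiding `φ(η)` (★ `CartierDivisorClassPullback.pullbackAvoiding`);
* **`IsEffective.ncard_setOf_not_avoids_apply_le_degree`**, `…card_le_degree_pullbackAvoiding` — for a morphism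
  `φ : C → X` to an integral scheme and an effective divisor `H` on `X` with `φ(η_C) ∉ Supp H` («`C` does not lie on
  `H`»), the closed points of `C` mapping into `Supp H` number at most `deg_C (φ^* H)` — «`#(C ∩ H) ≤ (C · H)`» for a
  hypersurface ∕ hyperplane section `H` of `C → ℙ^m` or of `C → A ↪ ℙ^m`.

The degree is [Fulton1998, Def. 1.4]; the inequality is the trivial half of Bézout as used in [MumfordFogartyKirwan1994,
Ch. 7 §3, proof of Prop. 7.7 (pp. 138–139)] and [Hartshorne1977, I Thm. 7.7].  HC_CM is proved only modulo the 7 printed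
citations until rung 0 closes.

## References
* [MumfordFogartyKirwan1994] D. Mumford, J. Fogarty, F. Kirwan, *Geometric Invariant Theory*, 3rd ed. (1994), Ch. 7 §3 Prop. 7.7 (pp. 138–139).
* [Fulton1998] W. Fulton, *Intersection Theory*, 2nd ed. (1998), Def. 1.4 (p. 13), §2.3.
* [Hartshorne1977] R. Hartshorne, *Algebraic Geometry* (1977), I Thm. 7.7 (p. 53), IV §1.
* [GortzWedhorn2020] U. Görtz, T. Wedhorn, *Algebraic Geometry I*, 2nd ed. (2020), Section (11.9) (p. 301), (11.13.4) (pp. 309–310), Def. 11.49 (p. 315).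
-/

set_option autoImplicit false

noncomputable section

universe u

open CategoryTheory AlgebraicGeometry Order Topology

namespace Literature.AlgebraicGeometry.Motives

namespace CartierDivisor

open RatFn

section Degree

variable {K : Type u} [Field K] {C : SchemeOver K} [IsIntegral C.left] [IsProper C.hom]

/-- A point not avoided by `D` lies in some chart whose local equation is not a unit there («`Supp(D) = {x ; (f_i)_x ∉ 𝒪_{X,x}^×}`»).
[cite: GortzWedhorn2020, Section (11.9) (p. 301)] -/
theorem exists_not_isUnitAt_of_not_avoids {X : Scheme.{u}} [IsIntegral X] {D : CartierDivisor X} {x : X}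
    (hx : ¬ D.Avoids x) : ∃ i, x ∈ D.U i ∧ ¬ IsUnitAt x (D.f i) := by
  by_contra h
  push Not at h
  exact hx fun i hi => h i hi

/-- **An effective divisor on an integral proper curve has, counted with residue degrees, at most `deg D` zeros**:
for a finite set `S` of closed points of `C` none of which `D` avoids, `Σ_{x ∈ S} [κ(x) : K] ≤ deg D`
(`deg D = Σ_x ord_x(D)·[κ(x):K]` with all terms `≥ 0` and `ord_x(D) ≥ 1` on `S`).
[cite: Fulton1998, Def. 1.4 (p. 13)] -/
theorem IsEffective.sum_residueDegree_le_degree (hC : height (⊤ : ↥C.left) = 1) {D : CartierDivisor C.left}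
    (hD : D.IsEffective) (S : Finset C.left) (hS : ∀ x ∈ S, height x = 0 ∧ ¬ D.Avoids x) :
    ∑ x ∈ S, ((toSpecOver C).left.residueDegree x : ℤ) ≤ degree C D := by
  classical
  rw [degree_eq_finsum]
  have hfin : (Function.support fun y => D.ordAt y * ((toSpecOver C).left.residueDegree y : ℤ)).Finite :=
    (finite_support_cycle D).subset (Function.support_mul_subset_left _ _)
  rw [finsum_eq_sum _ hfin]
  have hterm : ∀ x ∈ S, ((toSpecOver C).left.residueDegree x : ℤ) ≤
      D.ordAt x * ((toSpecOver C).left.residueDegree x : ℤ) := by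
    intro x hx
    obtain ⟨hx0, hxD⟩ := hS x hx
    obtain ⟨i, hi, hu⟩ := exists_not_isUnitAt_of_not_avoids hxD
    have hord : 1 ≤ D.ordAt x := hD.ordAt_pos hi hu (coheight_eq_one_of_height_eq_zero hC hx0)
    calc ((toSpecOver C).left.residueDegree x : ℤ) = 1 * ((toSpecOver C).left.residueDegree x : ℤ) := (one_mul _).symm
      _ ≤ D.ordAt x * ((toSpecOver C).left.residueDegree x : ℤ) :=
        mul_le_mul_of_nonneg_right hord (Nat.cast_nonneg _)
  calc ∑ x ∈ S, ((toSpecOver C).left.residueDegree x : ℤ)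
      ≤ ∑ x ∈ S, D.ordAt x * ((toSpecOver C).left.residueDegree x : ℤ) := Finset.sum_le_sum hterm
    _ ≤ ∑ x ∈ S ∪ hfin.toFinset, D.ordAt x * ((toSpecOver C).left.residueDegree x : ℤ) :=
        Finset.sum_le_sum_of_subset_of_nonneg Finset.subset_union_left
          (fun y _ _ => mul_nonneg (hD.ordAt_nonneg y) (Nat.cast_nonneg _))
    _ = ∑ x ∈ hfin.toFinset, D.ordAt x * ((toSpecOver C).left.residueDegree x : ℤ) := by
        refine (Finset.sum_subset Finset.subset_union_right fun y _ hy => ?_).symm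
        rwa [Set.Finite.mem_toFinset, Function.notMem_support] at hy

/-- Every Cartier divisor avoids the generic point `⊤` (its local equations are nonzero rational functions, units of
`𝒪_{X,η} = K(X)`; `Supp(D)` is a proper closed subset). [cite: GortzWedhorn2020, Section (11.9) (p. 301)] -/
theorem avoids_top {X : Scheme.{u}} [IsIntegral X] (D : CartierDivisor X) : D.Avoids (⊤ : X) :=
  fun i _ => isUnitAt_genericPoint (D.f_ne_zero i)

/-- On an integral curve (`height ⊤ = 1`) a point NOT avoided by a divisor `D` (a zero or pole of `D`) is a closed point
(`Supp(D)` is a proper closed subset of the irreducible curve). [cite: GortzWedhorn2020, Section (11.9) (p. 301)] -/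
theorem height_eq_zero_of_not_avoids {X : Scheme.{u}} [IsIntegral X] (hX : height (⊤ : X) = 1)
    {D : CartierDivisor X} {x : X} (hx : ¬ D.Avoids x) : height x = 0 := by
  have hne : x ≠ ⊤ := fun h => hx (h ▸ avoids_top D)
  have hnot : ¬ ((⊤ : X) ≤ x) := fun h =>
    hne (((AlgebraicGeometry.Scheme.le_iff_specializes.mp h).antisymm (genericPoint_specializes x)).eq)
  have hlt : x < ⊤ := lt_of_le_not_ge le_top hnot
  have hfin : height x < ⊤ :=
    lt_of_le_of_lt (Order.height_mono hlt.le) (by rw [hX]; exact ENat.coe_lt_top 1)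
  have h := Order.height_strictMono hlt hfin
  rw [hX] at h
  exact Order.lt_one_iff.mp h

/-- **The zeros of an effective divisor on an integral proper curve are finite in number** (they lie in the support of
the Weil cycle `cyc(D)`, ★ `finite_support_cycle`; «only finitely many `C ∈ X¹` with `ord_C(D) ≠ 0`»).
[cite: GortzWedhorn2020, (11.13.4) (pp. 309–310)] -/
theorem IsEffective.finite_setOf_not_avoids (hC : height (⊤ : ↥C.left) = 1) {D : CartierDivisor C.left}
    (hD : D.IsEffective) : {x : C.left | ¬ D.Avoids x}.Finite := by
  refine (finite_support_cycle D).subset fun x hx => ?_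
  obtain ⟨i, hi, hu⟩ := exists_not_isUnitAt_of_not_avoids hx
  rw [Function.mem_support, cycle_apply]
  exact (hD.ordAt_pos hi hu (coheight_eq_one_of_height_eq_zero hC (height_eq_zero_of_not_avoids hC hx))).ne'

/-- **An effective divisor on an integral proper curve has at most `deg D` zeros** (closed points, counted without
multiplicity or residue degree). [cite: MumfordFogartyKirwan1994, Ch. 7 §3 Prop. 7.7 (proof, pp. 138–139)] -/
theorem IsEffective.ncard_setOf_not_avoids_le_degree (hC : height (⊤ : ↥C.left) = 1) {D : CartierDivisor C.left}
    (hD : D.IsEffective) : (({x : C.left | ¬ D.Avoids x}.ncard : ℕ) : ℤ) ≤ degree C D := by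
  classical
  have hfin := hD.finite_setOf_not_avoids hC
  rw [Set.ncard_eq_toFinset_card _ hfin]
  have hS : ∀ x ∈ hfin.toFinset, height x = 0 ∧ ¬ D.Avoids x := fun x hx => by
    rw [Set.Finite.mem_toFinset] at hx
    exact ⟨height_eq_zero_of_not_avoids hC hx, hx⟩
  calc ((hfin.toFinset.card : ℕ) : ℤ) = ∑ x ∈ hfin.toFinset, (1 : ℤ) := by simp
    _ ≤ ∑ x ∈ hfin.toFinset, ((toSpecOver C).left.residueDegree x : ℤ) :=
        Finset.sum_le_sum fun x hx => by
          exact_mod_cast Nat.one_le_iff_ne_zero.mpr (residueDegree_toSpecOver_ne_zero (hS x hx).1)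
    _ ≤ degree C D := hD.sum_residueDegree_le_degree hC _ hS

/-- **A finite set of zeros of an effective divisor has at most `deg D` elements** (`Finset` form of the count).
[cite: MumfordFogartyKirwan1994, Ch. 7 §3 Prop. 7.7 (proof, pp. 138–139)] -/
theorem IsEffective.card_le_degree (hC : height (⊤ : ↥C.left) = 1) {D : CartierDivisor C.left}
    (hD : D.IsEffective) (S : Finset C.left) (hS : ∀ x ∈ S, ¬ D.Avoids x) : (S.card : ℤ) ≤ degree C D := by
  classical
  calc (S.card : ℤ) = ((S : Set C.left).ncard : ℤ) := by rw [Set.ncard_coe_finset]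
    _ ≤ (({x : C.left | ¬ D.Avoids x}.ncard : ℕ) : ℤ) := by
        exact_mod_cast Set.ncard_le_ncard (fun x hx => hS x (Finset.mem_coe.mp hx)) (hD.finite_setOf_not_avoids hC)
    _ ≤ degree C D := hD.ncard_setOf_not_avoids_le_degree hC

end Degree

/-! ### Points of a curve on a hypersurface section: zeros of the pulled-back divisor -/

section Pullback

variable {X : Scheme.{u}} [IsIntegral X] {Y : Scheme.{u}} [IsIntegral Y] (φ : Y ⟶ X)

/-- If `H` avoids `φ(y)` then the pulled-back divisor `φ^* H` avoids `y` (`Supp φ^*H ⊆ φ⁻¹ Supp H`; the inverse image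
divisor of [GortzWedhorn2020, Def. 11.49]). [cite: GortzWedhorn2020, Def. 11.49 (p. 315)] -/
theorem Avoids.pullbackAvoiding_of_apply {H : CartierDivisor X} (hφ : H.Avoids (φ (genericPoint Y))) {y : Y}
    (h : H.Avoids (φ y)) : (H.pullbackAvoiding φ hφ).Avoids y := by
  obtain ⟨j, hj⟩ := (H.pullbackAvoiding φ hφ).covers y
  exact Avoids.of_mem hj (h j.1 hj).pullbackFn

/-- For an EFFECTIVE divisor `H` on `X` avoiding `φ(η_Y)`, the pulled-back divisor `φ^* H` avoids `y` iff `H` avoids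
`φ(y)` (`Supp φ^*H = φ⁻¹ Supp H`: the local equations `φ^♯ f_i` are units at `y` iff the `f_i`, regular at `φ(y)`, are
units there — stalk maps are local). [cite: GortzWedhorn2020, Def. 11.49 (p. 315)] -/
theorem IsEffective.avoids_pullbackAvoiding_iff {H : CartierDivisor X} (hH : H.IsEffective)
    (hφ : H.Avoids (φ (genericPoint Y))) (y : Y) :
    (H.pullbackAvoiding φ hφ).Avoids y ↔ H.Avoids (φ y) := by
  refine ⟨fun h => ?_, Avoids.pullbackAvoiding_of_apply φ hφ⟩
  obtain ⟨j, hj⟩ := (H.pullbackAvoiding φ hφ).covers y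
  exact Avoids.of_mem hj ((hH j.1 (φ y) hj).isUnitAt_of_pullbackFn (h j hj))

end Pullback

section PullbackDegree

variable {K : Type u} [Field K] {C : SchemeOver K} [IsIntegral C.left] [IsProper C.hom]
  {X : Scheme.{u}} [IsIntegral X] (φ : C.left ⟶ X)

/-- **Points of a curve on a hypersurface section.** Let `C` be an integral proper curve over a field `K`, `φ : C → X` a
morphism to an integral scheme and `H` an EFFECTIVE Cartier divisor on `X` whose support does not contain `φ(η_C)`
(«`C` does not lie on `H`»).  Then the closed points of `C` mapping into `Supp H` are finitely many and their number is
at most `deg φ^* H`: `#{x ∈ C | φ(x) ∈ Supp H} ≤ deg_C (φ^* H)`.  For `X = ℙ^m` (or an abelian variety `A ↪ ℙ^m`)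
and `H` a hyperplane section this is «`#(C ∩ H) ≤ (C · H) = deg C`», the count used in
[MumfordFogartyKirwan1994, Ch. 7 §3, proof of Prop. 7.7]. [cite: MumfordFogartyKirwan1994, Ch. 7 §3 Prop. 7.7 (proof, pp. 138–139)] -/
theorem IsEffective.ncard_setOf_not_avoids_apply_le_degree (hC : height (⊤ : ↥C.left) = 1) {H : CartierDivisor X}
    (hH : H.IsEffective) (hφ : H.Avoids (φ (genericPoint C.left))) :
    (({x : C.left | ¬ H.Avoids (φ x)}.ncard : ℕ) : ℤ) ≤ degree C (H.pullbackAvoiding φ hφ) := by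
  have heq : {x : C.left | ¬ H.Avoids (φ x)} = {x : C.left | ¬ (H.pullbackAvoiding φ hφ).Avoids x} := by
    ext x
    simp only [Set.mem_setOf_eq, hH.avoids_pullbackAvoiding_iff φ hφ]
  rw [heq]
  exact (hH.pullbackAvoiding φ hφ).ncard_setOf_not_avoids_le_degree hC

/-- The set of closed points of `C` mapping into `Supp H` is finite (`H` effective, `φ(η_C) ∉ Supp H`).
[cite: GortzWedhorn2020, (11.13.4) (pp. 309–310)] -/
theorem IsEffective.finite_setOf_not_avoids_apply (hC : height (⊤ : ↥C.left) = 1) {H : CartierDivisor X}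
    (hH : H.IsEffective) (hφ : H.Avoids (φ (genericPoint C.left))) :
    {x : C.left | ¬ H.Avoids (φ x)}.Finite := by
  have heq : {x : C.left | ¬ H.Avoids (φ x)} = {x : C.left | ¬ (H.pullbackAvoiding φ hφ).Avoids x} := by
    ext x
    simp only [Set.mem_setOf_eq, hH.avoids_pullbackAvoiding_iff φ hφ]
  rw [heq]
  exact (hH.pullbackAvoiding φ hφ).finite_setOf_not_avoids hC

/-- `Finset` form: a finite set of closed points of `C` all mapping into `Supp H` has at most `deg φ^*H` elements.
[cite: MumfordFogartyKirwan1994, Ch. 7 §3 Prop. 7.7 (proof, pp. 138–139)] -/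
theorem IsEffective.card_le_degree_pullbackAvoiding (hC : height (⊤ : ↥C.left) = 1) {H : CartierDivisor X}
    (hH : H.IsEffective) (hφ : H.Avoids (φ (genericPoint C.left))) (S : Finset C.left)
    (hS : ∀ x ∈ S, ¬ H.Avoids (φ x)) : (S.card : ℤ) ≤ degree C (H.pullbackAvoiding φ hφ) :=
  (hH.pullbackAvoiding φ hφ).card_le_degree hC S fun x hx =>
    (not_congr (hH.avoids_pullbackAvoiding_iff φ hφ x)).mpr (hS x hx)

end PullbackDegree

end CartierDivisor

end Literature.AlgebraicGeometry.Motives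

end
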